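import Summits.Schanuel.Schanuel.Theorems.RootDecomp1BDefectFloorCellsKit

/-!
# RootDecomp1BDefectFloorCells (part 2 of 2; part 1 = RootDecomp1BDefectFloorCellsKit, same namespace) — DECIDED CELLS of the defect floor (lens 4 gen 9, node `DefectFloor`): the Lindemann–Weierstrass family (β | e^γ) at every length, its certified wild direction, the Nesterenko flag (π | Γ(1/4))

Extracted mechanically (dependency closure) from HOME/decomp-schanuel-lens-4/g9/DefectFloor.lean (critic-screened node,
round 9 of RootDecomp1B); identical twins of landed `RootDecomp1BFedFlag{Defs,Core}` / `RootDecomp1BTameFlag{Defs,Core,Steps}`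
declarations are `open`ed by name, not restated; sorry-free; standard axioms.
-/

open Complex IntermediateField
open Literature.NumberTheory.Transcendental (trdeg_adjoin_le_of_le isAlgebraic_adjoin_over_algebraAdjoin nesterenko)

namespace Summit.Schanuel.Schanuel.Theorems.RootDecomp1BDefectFloorCells

set_option linter.dupNamespace false

open Summit.Schanuel.Schanuel.Theorems.RootDecomp1BFedFlagCore (KleinIH polarDeg baseField polarField trdeg_adjoin_lt_aleph0 polarDeg_lt_aleph0 coe_mem_adjoin_of_mem_span coe_mem_polarField exp_coe_mem_polarField exp_coe_mul_I_mem_polarField)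
open Summit.Schanuel.Schanuel.Theorems.RootDecomp1BTameFlagCore (baseDeg pairDeg IsWild LastTame trdeg_adjoin_le_cardinalMk isAlgebraic_I init_mem_span)
open Summit.Schanuel.Schanuel.Theorems.RootDecomp1BDefectFloorDefs (SharpRelativeLindemannAt TameDefectZeroAt WildSharpDefectZeroAt)

section

variable {m : ℕ}

/-- (private copy; a landed twin exists in another cone) `i` is algebraic over `ℚ` … -/
private theorem isAlgebraic_I_rat : IsAlgebraic ℚ Complex.I :=
  IsAlgebraic.of_pow two_pos (by rw [Complex.I_sq]; exact isAlgebraic_one.neg)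

/-- Algebraic independence of real numbers survives the embedding `ℝ ⊂ ℂ`. -/
theorem algebraicIndependent_ofReal {k : ℕ} {w : Fin k → ℝ} (h : AlgebraicIndependent ℚ w) :
    AlgebraicIndependent ℚ (fun i => ((w i : ℝ) : ℂ)) := by
  have e : (fun i => ((w i : ℝ) : ℂ)) = (Complex.ofRealAm.restrictScalars ℚ) ∘ w := by
    funext i
    simp
  rw [e]
  exact h.map' Complex.ofReal_injective

/-- NESTERENKO (1996) = the tree's NAMED FACT `Literature.NumberTheory.Transcendental.nesterenko`
(`PeriodsWave0.lean`; PROVED in the tree: `nesterenko_holds` in `PeriodsWave0NesterenkoProofs.lean` — this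
node imports only the statement module and carries the fact as the hypothesis `hN`, discharged by
`nesterenko_holds` wherever that module is imported): π, e^π, Γ(1/4) are algebraically independent over ℚ.
[cite: NesterenkoPhilippon2001, Ch. 3 Theorem 1.1 and Corollary 1.2] -/
theorem algebraicIndependent_piExpPiGamma (hN : nesterenko) : AlgebraicIndependent ℚ piExpPiGamma :=
  hN

/-- an ALGEBRAIC tuple is a SHARP hyperplane: `t(β) ≤ 2m` (ρ = 0 and `t + ρ ≤ a + b ≤ 2ρ + 2m`). -/
theorem polarDeg_le_two_mul_of_algebraic (β : Fin m → ℝ) (hβ : ∀ j, IsAlgebraic ℚ ((β j : ℝ) : ℂ)) :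
    polarDeg β ≤ ((m + m : ℕ) : Cardinal) := by
  have hρ : baseDeg β = 0 := by
    apply le_antisymm _ bot_le
    haveI : Algebra.IsAlgebraic ℚ ↥(baseField β) :=
      isAlgebraic_adjoin fun x hx => by
        obtain ⟨j, rfl⟩ := hx
        exact (hβ j).isIntegral
    exact (trdeg_eq_zero (R := ℚ) (A := ↥(baseField β))).le
  have h1 := modDeg_le_baseDeg_add β
  have h2 := phaseDeg_le_baseDeg_add β
  have h3 := polarDeg_add_baseDeg_le β
  rw [hρ] at h1 h2 h3
  obtain ⟨na, hna⟩ := Cardinal.lt_aleph0.mp (modDeg_lt_aleph0 β)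
  obtain ⟨nb, hnb⟩ := Cardinal.lt_aleph0.mp (phaseDeg_lt_aleph0 β)
  obtain ⟨nt, hnt⟩ := Cardinal.lt_aleph0.mp (polarDeg_lt_aleph0 β)
  rw [hna] at h1 h3
  rw [hnb] at h2 h3
  rw [hnt] at h3 ⊢
  norm_cast at h1 h2 h3 ⊢
  omega

/-- a `ℚ`-combination of algebraic reals is algebraic. -/
theorem isAlgebraic_of_mem_span_algebraic (β : Fin m → ℝ) (hβ : ∀ j, IsAlgebraic ℚ ((β j : ℝ) : ℂ)) {v : ℝ}
    (hv : v ∈ Submodule.span ℚ (Set.range β)) : IsAlgebraic ℚ ((v : ℝ) : ℂ) := by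
  have hmem := coe_mem_adjoin_of_mem_span β hv
  have hK : Algebra.IsAlgebraic ℚ ↥(IntermediateField.adjoin ℚ (Set.range (fun j => ((β j : ℝ) : ℂ)))) :=
    isAlgebraic_adjoin fun x hx => by
      obtain ⟨j, rfl⟩ := hx
      exact (hβ j).isIntegral
  have h := hK.isAlgebraic ⟨_, hmem⟩
  exact IntermediateField.isAlgebraic_iff.mp h

/-- the polar exponents `s, i s` of an algebraic tuple are algebraic. -/
theorem isAlgebraic_polarExp (s : Fin m → ℝ) (hs : ∀ j, IsAlgebraic ℚ ((s j : ℝ) : ℂ))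
    (i : Fin (m + m)) :
    IsAlgebraic ℚ (Fin.append (fun j => ((s j : ℝ) : ℂ)) (fun j => ((s j : ℝ) : ℂ) * Complex.I) i) := by
  induction i using Fin.addCases with
  | left j => simpa only [Fin.append_left] using hs j
  | right j => simpa only [Fin.append_right] using (hs j).mul isAlgebraic_I_rat

/-- the exponentials of the first `2m + 1` polar exponents of `(β | γ)` — all but `e^{iγ}` — lie in the polar field
of `(β | e^γ)`: `e^{β_j}`, `e^{iβ_j}` as exponentials of coordinates, `e^γ` as a COORDINATE. -/
theorem exp_polarExp_snoc_mem_polarField (β : Fin m → ℝ) (γ : ℝ) (i : Fin ((m + 1) + (m + 1)))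
    (hi : (i : ℕ) < m + m + 1) :
    Complex.exp (Fin.append (fun j => (((Fin.snoc β γ : Fin (m + 1) → ℝ) j : ℝ) : ℂ))
        (fun j => (((Fin.snoc β γ : Fin (m + 1) → ℝ) j : ℝ) : ℂ) * Complex.I) i) ∈
      polarField (Fin.snoc β (Real.exp γ) : Fin (m + 1) → ℝ) := by
  induction i using Fin.addCases with
  | left j =>
    rcases Fin.eq_castSucc_or_eq_last j with ⟨j, rfl⟩ | rfl
    · simpa only [Fin.append_left, Fin.snoc_castSucc] using
        exp_coe_mem_polarField (Fin.snoc β (Real.exp γ) : Fin (m + 1) → ℝ) (Fin.castSucc j)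
    · simpa only [Fin.append_left, Fin.snoc_last, Complex.ofReal_exp] using
        coe_mem_polarField (Fin.snoc β (Real.exp γ) : Fin (m + 1) → ℝ) (Fin.last m)
  | right j =>
    rcases Fin.eq_castSucc_or_eq_last j with ⟨j, rfl⟩ | rfl
    · simpa only [Fin.append_right, Fin.snoc_castSucc] using
        exp_coe_mul_I_mem_polarField (Fin.snoc β (Real.exp γ) : Fin (m + 1) → ℝ) (Fin.castSucc j)
    · exfalso
      rw [Fin.val_natAdd, Fin.val_last] at hi
      omega

/-- THE FLOOR IS DECIDED ON THE LINDEMANN–WEIERSTRASS FAMILY, at every length: for β₁, …, β_m, γ real algebraic with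
(β, γ) `ℚ`-free, `t(β | e^γ) ≥ 2m + 1` — the `2m + 1` exponentials e^{β_j}, e^{iβ_j}, e^γ of `ℚ`-linearly
independent algebraic numbers lie in F(β | e^γ) and are algebraically independent [Lindemann–Weierstrass:
`Literature.NumberTheory.Transcendental.algebraicIndependent_exp_holds`].  X at the same tuple — «t ≥ 2m + 2»:
e^{e^γ} or e^{ie^γ} transcendental over ℚ(e^β, e^{iβ}, e^γ) — is OPEN: the cell lies OUTSIDE the regime where X is
known (flagship (√2 | e)). -/
theorem floor_snoc_exp (β : Fin m → ℝ) (γ : ℝ) (hβ : ∀ j, IsAlgebraic ℚ ((β j : ℝ) : ℂ))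
    (hγ : IsAlgebraic ℚ ((γ : ℝ) : ℂ)) (hli : LinearIndependent ℚ (Fin.snoc β γ : Fin (m + 1) → ℝ)) :
    ((m + m + 1 : ℕ) : Cardinal) ≤ polarDeg (Fin.snoc β (Real.exp γ) : Fin (m + 1) → ℝ) := by
  have hA := linearIndependent_polar hli
  have hle : m + m + 1 ≤ (m + 1) + (m + 1) := by omega
  have hsalg : ∀ j, IsAlgebraic ℚ ((((Fin.snoc β γ : Fin (m + 1) → ℝ) j : ℝ)) : ℂ) := by
    intro j
    rcases Fin.eq_castSucc_or_eq_last j with ⟨j, rfl⟩ | rfl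
    · simp only [Fin.snoc_castSucc]; exact hβ j
    · simp only [Fin.snoc_last]; exact hγ
  have hLW := Literature.NumberTheory.Transcendental.algebraicIndependent_exp_holds _
    (fun k => isAlgebraic_polarExp (Fin.snoc β γ : Fin (m + 1) → ℝ) hsalg (Fin.castLE hle k))
    (hA.comp (Fin.castLE hle) (Fin.castLE_injective hle))
  exact natCast_le_trdeg_of_algebraicIndependent hLW
    (fun k => exp_polarExp_snoc_mem_polarField β γ (Fin.castLE hle k) (by exact k.isLt))

/-- THE CELL `SharpRelativeLindemannAt m (β | e^γ)` IS A THEOREM. -/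
theorem sharpRelativeLindemannAt_snoc_exp (β : Fin m → ℝ) (γ : ℝ) (hβ : ∀ j, IsAlgebraic ℚ ((β j : ℝ) : ℂ))
    (hγ : IsAlgebraic ℚ ((γ : ℝ) : ℂ)) (hli : LinearIndependent ℚ (Fin.snoc β γ : Fin (m + 1) → ℝ)) :
    SharpRelativeLindemannAt m (Fin.snoc β (Real.exp γ) : Fin (m + 1) → ℝ) :=
  fun _ _ _ => floor_snoc_exp β γ hβ hγ hli

/-- … and its structural hypotheses are THEOREMS: the hyperplane (β) IS sharp … -/
theorem sharp_init_snoc_exp (β : Fin m → ℝ) (γ : ℝ) (hβ : ∀ j, IsAlgebraic ℚ ((β j : ℝ) : ℂ)) :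
    polarDeg (Fin.init (Fin.snoc β (Real.exp γ) : Fin (m + 1) → ℝ)) ≤ ((m + m : ℕ) : Cardinal) := by
  rw [Fin.init_snoc]
  exact polarDeg_le_two_mul_of_algebraic β hβ

/-- … and (β | e^γ) IS `ℚ`-free: `span_ℚ(β) ⊂ ℚ̄` while e^γ is transcendental (Hermite–Lindemann, γ ≠ 0). -/
theorem linearIndependent_snoc_exp (β : Fin m → ℝ) (γ : ℝ) (hβ : ∀ j, IsAlgebraic ℚ ((β j : ℝ) : ℂ))
    (hγ : IsAlgebraic ℚ ((γ : ℝ) : ℂ)) (hli : LinearIndependent ℚ (Fin.snoc β γ : Fin (m + 1) → ℝ)) :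
    LinearIndependent ℚ (Fin.snoc β (Real.exp γ) : Fin (m + 1) → ℝ) := by
  have hpair := linearIndependent_finSnoc.mp hli
  have hγ0 : γ ≠ 0 := by
    have h := hli.ne_zero (Fin.last m)
    rwa [Fin.snoc_last] at h
  refine linearIndependent_finSnoc.mpr ⟨hpair.1, fun hmem => ?_⟩
  have halg : IsAlgebraic ℚ ((Real.exp γ : ℝ) : ℂ) := isAlgebraic_of_mem_span_algebraic β hβ hmem
  have hT : AlgebraicIndependent ℚ fun i : Fin 1 => Complex.exp (![((γ : ℝ) : ℂ)] i) :=
    Literature.NumberTheory.Transcendental.algebraicIndependent_exp_holds _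
      (fun i => by fin_cases i; exact hγ) (linearIndependent_unique_iff.mpr (by simpa using hγ0))
  have hT0 := hT.transcendental 0
  simp only [Matrix.cons_val_fin_one, ← Complex.ofReal_exp] at hT0
  exact hT0 halg

/-- the exponentials e^v, e^{γ'}, e^{iv} (the first three polar exponents of the pair (v, γ')) lie in
`ℚ(r, e^v, e^{iv})` when `e^{γ'}` is the last COORDINATE of `r`. -/
theorem exp_polarExp_pair_mem (r : Fin (m + 1) → ℝ) (v γ' : ℝ)
    (hlast : ((r (Fin.last m) : ℝ) : ℂ) = Complex.exp ((γ' : ℝ) : ℂ)) (i : Fin (2 + 2)) (hi : (i : ℕ) < 3) :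
    Complex.exp (Fin.append (fun j => ((![v, γ'] j : ℝ) : ℂ)) (fun j => ((![v, γ'] j : ℝ) : ℂ) * Complex.I) i) ∈
      IntermediateField.adjoin ℚ (Set.range (fun j => ((r j : ℝ) : ℂ)) ∪
        {Complex.exp ((v : ℝ) : ℂ), Complex.exp (((v : ℝ) : ℂ) * Complex.I)}) := by
  induction i using Fin.addCases with
  | left j =>
    rw [Fin.append_left]
    fin_cases j
    · exact subset_adjoin ℚ _ (Or.inr (Set.mem_insert _ _))
    · show Complex.exp (((![v, γ'] 1 : ℝ)) : ℂ) ∈ _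
      have e : (![v, γ'] 1 : ℝ) = γ' := rfl
      rw [e, ← hlast]
      exact subset_adjoin ℚ _ (Or.inl ⟨Fin.last m, rfl⟩)
  | right j =>
    rw [Fin.append_right]
    fin_cases j
    · exact subset_adjoin ℚ _ (Or.inr (Set.mem_insert_of_mem _ rfl))
    · exfalso
      simp at hi

/-- In `(β | e^γ)` (β_j, γ real algebraic, (β, γ) `ℚ`-free) EVERY nonzero `v ∈ span_ℚ(β)` is a WILD direction:
`trdeg ℚ(r, e^v, e^{iv}) ≥ 3 ≥ trdeg ℚ(r) + 2` (e^v, e^γ, e^{iv} are algebraically independent by Lindemann–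
Weierstrass and lie in ℚ(r, e^v, e^{iv}); `trdeg ℚ(r) ≤ 1`).  The first certified wild directions of the cell in a
tuple where X is open (whether the remaining directions, those involving e^γ, are wild — i.e. whether the TUPLE is
wild — is itself open: e^{e^γ}, e^{ie^γ}). -/
theorem wild_direction_snoc_exp (β : Fin m → ℝ) (γ : ℝ) (hβ : ∀ j, IsAlgebraic ℚ ((β j : ℝ) : ℂ))
    (hγ : IsAlgebraic ℚ ((γ : ℝ) : ℂ)) (hli : LinearIndependent ℚ (Fin.snoc β γ : Fin (m + 1) → ℝ))
    {v : ℝ} (hv : v ∈ Submodule.span ℚ (Set.range β)) (hv0 : v ≠ 0) :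
    baseDeg (Fin.snoc β (Real.exp γ) : Fin (m + 1) → ℝ) + 2 ≤
      pairDeg (Fin.snoc β (Real.exp γ) : Fin (m + 1) → ℝ) v := by
  have hγspan : γ ∉ Submodule.span ℚ (Set.range β) := (linearIndependent_finSnoc.mp hli).2
  have hvalg : IsAlgebraic ℚ ((v : ℝ) : ℂ) := isAlgebraic_of_mem_span_algebraic β hβ hv
  -- ρ(β | e^γ) ≤ 1
  have hρ : baseDeg (Fin.snoc β (Real.exp γ) : Fin (m + 1) → ℝ) ≤ 1 := by
    refine baseDeg_le_one_of_algebraic_off_one _ (Fin.last m) fun j hj => ?_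
    rcases Fin.eq_castSucc_or_eq_last j with ⟨j, rfl⟩ | rfl
    · simp only [Fin.snoc_castSucc]
      exact hβ j
    · exact absurd rfl hj
  -- (v, γ) is ℚ-free
  have h2 : LinearIndependent ℚ ![v, γ] := by
    refine LinearIndependent.pair_iff.mpr fun s t hst => ?_
    by_cases ht : t = 0
    · subst ht
      simp only [zero_smul, add_zero, smul_eq_zero] at hst
      exact ⟨hst.resolve_right hv0, rfl⟩
    · exfalso
      apply hγspan
      have e : t • γ = -(s • v) := by
        rw [← sub_eq_zero, sub_neg_eq_add, add_comm]
        exact hst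
      have hmem : t • γ ∈ Submodule.span ℚ (Set.range β) := by
        rw [e]
        exact Submodule.neg_mem _ (Submodule.smul_mem _ _ hv)
      have h' := Submodule.smul_mem _ t⁻¹ hmem
      rwa [smul_smul, inv_mul_cancel₀ ht, one_smul] at h'
  -- e^v, e^γ, e^{iv} algebraically independent, inside ℚ(r, e^v, e^{iv})
  have h3 : ((3 : ℕ) : Cardinal) ≤ pairDeg (Fin.snoc β (Real.exp γ) : Fin (m + 1) → ℝ) v := by
    have hA := linearIndependent_polar h2
    have hle : 3 ≤ 2 + 2 := by omega
    have halg : ∀ j, IsAlgebraic ℚ ((![v, γ] j : ℝ) : ℂ) := by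
      intro j
      fin_cases j
      · exact hvalg
      · exact hγ
    have hLW := Literature.NumberTheory.Transcendental.algebraicIndependent_exp_holds _
      (fun k => isAlgebraic_polarExp ![v, γ] halg (Fin.castLE hle k))
      (hA.comp (Fin.castLE hle) (Fin.castLE_injective hle))
    refine natCast_le_trdeg_of_algebraicIndependent hLW fun k => ?_
    exact exp_polarExp_pair_mem _ v γ (by simp [Fin.snoc_last, Complex.ofReal_exp]) (Fin.castLE hle k)
      (by exact k.isLt)
  calc baseDeg (Fin.snoc β (Real.exp γ) : Fin (m + 1) → ℝ) + 2 ≤ (1 : Cardinal) + 2 := add_le_add hρ le_rfl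
    _ = ((3 : ℕ) : Cardinal) := by norm_num
    _ ≤ _ := h3

/-- On the Lindemann–Weierstrass family the W0-cell — floor DECIDED (`floor_snoc_exp`), hyperplane (β) CERTIFIED sharp
(`polarDeg_le_two_mul_of_algebraic`), tuple certified `ℚ`-free — reads EXACTLY
«KleinIH (m+1) → (β | e^γ) wild → t(β | e^γ) ≥ 2m + 2» = X there for wild such tuples. -/
theorem wildSharpDefectZeroAt_snoc_exp_iff (β : Fin m → ℝ) (γ : ℝ) (hβ : ∀ j, IsAlgebraic ℚ ((β j : ℝ) : ℂ))
    (hγ : IsAlgebraic ℚ ((γ : ℝ) : ℂ)) (hli : LinearIndependent ℚ (Fin.snoc β γ : Fin (m + 1) → ℝ)) :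
    WildSharpDefectZeroAt m (Fin.snoc β (Real.exp γ) : Fin (m + 1) → ℝ) ↔
      (KleinIH (m + 1) → IsWild (m + 1) (Fin.snoc β (Real.exp γ) : Fin (m + 1) → ℝ) →
        ((m + 1 + (m + 1) : ℕ) : Cardinal) ≤ polarDeg (Fin.snoc β (Real.exp γ) : Fin (m + 1) → ℝ)) :=
  ⟨fun h hIH hW => h (linearIndependent_snoc_exp β γ hβ hγ hli) hIH hW
      ⟨β, (linearIndependent_finSnoc.mp hli).1,
        fun j => by simpa only [Fin.init_snoc] using init_mem_span (Fin.snoc β (Real.exp γ) : Fin (m + 1) → ℝ) j,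
        polarDeg_le_two_mul_of_algebraic β hβ⟩
      (floor_snoc_exp β γ hβ hγ hli),
    fun h _ hIH hW _ _ => h hIH hW⟩

/-- … and the T0-cell reads «KleinIH (m+1) → e^γ tame over (β | e^γ) → t ≥ 2m + 2». -/
theorem tameDefectZeroAt_snoc_exp_iff (β : Fin m → ℝ) (γ : ℝ) (hβ : ∀ j, IsAlgebraic ℚ ((β j : ℝ) : ℂ))
    (hγ : IsAlgebraic ℚ ((γ : ℝ) : ℂ)) (hli : LinearIndependent ℚ (Fin.snoc β γ : Fin (m + 1) → ℝ)) :
    TameDefectZeroAt m (Fin.snoc β (Real.exp γ) : Fin (m + 1) → ℝ) ↔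
      (KleinIH (m + 1) → LastTame m (Fin.snoc β (Real.exp γ) : Fin (m + 1) → ℝ) →
        ((m + 1 + (m + 1) : ℕ) : Cardinal) ≤ polarDeg (Fin.snoc β (Real.exp γ) : Fin (m + 1) → ℝ)) :=
  ⟨fun h hIH ht => h (linearIndependent_snoc_exp β γ hβ hγ hli) hIH ht (floor_snoc_exp β γ hβ hγ hli),
    fun h _ hIH ht _ => h hIH ht⟩

/-- NESTERENKO DECIDES THE FLOOR AT (π | Γ(1/4)): `t(π, Γ(1/4)) ≥ 3` — π, e^π, Γ(1/4) ∈ F(π, Γ(1/4)) are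
algebraically independent [Nesterenko 1996; named fact `Literature.NumberTheory.Transcendental.nesterenko`]. -/
theorem three_le_polarDeg_piGamma (hN : nesterenko) : ((3 : ℕ) : Cardinal) ≤ polarDeg piGamma := by
  have h := algebraicIndependent_ofReal (algebraicIndependent_piExpPiGamma hN)
  have e1 : ((piExpPiGamma 1 : ℝ) : ℂ) = Complex.exp ((piGamma 0 : ℝ) : ℂ) := by
    simp [piExpPiGamma, piGamma, Complex.ofReal_exp]
  refine natCast_le_trdeg_of_algebraicIndependent h fun i => ?_
  fin_cases i
  · exact coe_mem_polarField piGamma 0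
  · show ((piExpPiGamma 1 : ℝ) : ℂ) ∈ polarField piGamma
    rw [e1]
    exact exp_coe_mem_polarField piGamma 0
  · exact coe_mem_polarField piGamma 1

/-- THE CELL `SharpRelativeLindemannAt 1 (π | Γ(1/4))` IS A THEOREM (given Nesterenko) … -/
theorem sharpRelativeLindemannAt_piGamma (hN : nesterenko) : SharpRelativeLindemannAt 1 piGamma :=
  fun _ _ _ => by exact_mod_cast three_le_polarDeg_piGamma hN

/-- the same three numbers decide the floor at the re-based pair (Γ(1/4) | π). -/
theorem three_le_polarDeg_gammaPi (hN : nesterenko) : ((3 : ℕ) : Cardinal) ≤ polarDeg gammaPi := by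
  have h := algebraicIndependent_ofReal (algebraicIndependent_piExpPiGamma hN)
  have e1 : ((piExpPiGamma 1 : ℝ) : ℂ) = Complex.exp ((gammaPi 1 : ℝ) : ℂ) := by
    simp [piExpPiGamma, gammaPi, Complex.ofReal_exp]
  refine natCast_le_trdeg_of_algebraicIndependent h fun i => ?_
  fin_cases i
  · exact coe_mem_polarField gammaPi 1
  · show ((piExpPiGamma 1 : ℝ) : ℂ) ∈ polarField gammaPi
    rw [e1]
    exact exp_coe_mem_polarField gammaPi 1
  · exact coe_mem_polarField gammaPi 0

end

end Summit.Schanuel.Schanuel.Theorems.RootDecomp1BDefectFloorCells
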